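import Summits.Ventures.YMGap.FlowData.TubeFluxSectors
import Literature.MathematicalPhysics.QuantumLattice.SU2Haar
import HarnessLib

/-!
# Venture YMGap, track Y3 FLOW-DATA — AXIS SYMMETRY of the tube flux energies: a permutation `σ` of the coordinates
# of the spatial torus `(ℤ/L)^k` carries the flux sector `e` to `e ∘ σ` with the same sector top; in particular the
# torelon energy `E₁` is the same along every axis (theorems only)

HONEST FRAMING: venture file of the cell `pub-ymgap` (QuantumFields programme), track Y3; companion THEOREMS for
`FlowData/TorelonEnergy.lean` («by the symmetry of the cube all axes give the same number, not claimed here» — proved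
here: the FLOW-TABLE's axis-`0` column `E1` of a CUBIC cross-section is the torelon energy along every axis).
Finite spatial torus; no number, no row, nothing about limits or a mass gap.

For a permutation `σ` of `Fin k` let `Φ_σ a (y, j) = a (y ∘ σ, σ⁻¹ j)` (relabelling sites `x ↦ x ∘ σ⁻¹` and directions
`i ↦ σ i`).  Then
* `Φ_σ` preserves the slice measure (`measurePreserving_permConfig`), the spatial plaquette sum (`magSum_permConfig`;
  a plaquette whose orientation is reversed contributes `Re tr ρ(U_P⁻¹) = Re tr ρ(U_P)`, unitary `ρ`), the temporal
  plaquette sum (`elecSum_permConfig`) and hence the slice kernel (`sliceKernel_permConfig`);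
* the induced isometry `U_σ ψ = ψ ∘ Φ_σ` of `L²` commutes with the transfer operator (`permOp_comp_tubeTransferOperator`)
  and intertwines the twists, `Φ_σ ∘ twist_s = twist_{s ∘ σ⁻¹} ∘ Φ_σ` (`permConfig_fluxTwist`), hence the sector
  projections, `P_{e∘σ} ∘ U_σ = U_σ ∘ P_e` (`tubeFluxProjection_comp_permOp`);
* therefore **`tubeSectorNorm_perm`**: `‖T ∘ P_{e∘σ}‖ = ‖T ∘ P_e‖`, **`tubeFluxEnergy_perm`**, and for the cell's object
  **`su2TorelonEnergy_axis`**: `su2TorelonEnergy β k L μ = su2TorelonEnergy β k L ν` for all axes `μ, ν`, every `β`.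

References: G. 't Hooft, Nucl. Phys. B 153 (1979) 141 [cite: tHooft1979Flux]; M. Lüscher, Commun. Math. Phys. 54 (1977)
283 [cite: Luscher1977].
-/

noncomputable section

open scoped BigOperators ENNReal
open MeasureTheory Filter Function
open Literature.MathematicalPhysics.QuantumFieldTheory Literature.Analysis.OperatorTheory
open Literature.Barriers.QuantumFields

namespace Summit.Ventures.YMGap.FlowData

section Algebra

variable {G : Type*} [Group G] {n k L : ℕ} (ρ : G →* Matrix (Fin n) (Fin n) ℂ) (σ : Equiv.Perm (Fin k))

omit [Group G] in
/-- Relabelling the coordinates of a shifted site: `(y + ê_j) ∘ σ = y ∘ σ + ê_{σ⁻¹ j}`. [folklore] -/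
theorem comp_perm_add_single (y : Site k L) (j : Fin k) (c : ZMod L) :
    ((y + Pi.single j c : Site k L) ∘ σ) = (y ∘ σ : Site k L) + Pi.single (σ.symm j) c := by
  funext i
  simp only [comp_apply, Pi.add_apply, Pi.single_apply, Equiv.apply_eq_iff_eq_symm_apply]

/-- **The temporal plaquette sum is invariant under a coordinate permutation** (pure reindexing of sites and
directions). [folklore] -/
theorem elecSum_permConfig [NeZero L] (a b : GaugeConfig k L G) (E : Site k L → G) :
    elecSum (d := k) (L := L) ρ (fun e : Edge k L => a (e.1 ∘ σ, σ.symm e.2)) (fun y => E (y ∘ σ))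
        (fun e : Edge k L => b (e.1 ∘ σ, σ.symm e.2)) = elecSum (d := k) (L := L) ρ a E b := by
  unfold elecSum
  simp_rw [comp_perm_add_single σ]
  refine Fintype.sum_equiv ((Equiv.arrowCongr σ (Equiv.refl (ZMod L))).symm) _ _ fun y => ?_
  have hy : (Equiv.arrowCongr σ (Equiv.refl (ZMod L))).symm y = y ∘ σ := rfl
  rw [hy]
  exact Fintype.sum_equiv σ.symm _ _ fun j => rfl

/-- The oriented plaquette trace is symmetric under exchanging the two directions (the holonomy is inverted;
unitary `ρ`). [folklore] -/
theorem plaquetteTrace_symm [NeZero L] (hρu : ∀ g, ρ g ∈ Matrix.unitaryGroup (Fin n) ℂ) (a : GaugeConfig k L G)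
    (x : Site k L) (i j : Fin k) :
    (ρ (a (x, j) * a (x + Pi.single j 1, i) * (a (x + Pi.single i 1, j))⁻¹ * (a (x, i))⁻¹)).trace.re =
      (ρ (a (x, i) * a (x + Pi.single i 1, j) * (a (x + Pi.single j 1, i))⁻¹ * (a (x, j))⁻¹)).trace.re := by
  rw [← FiniteTemperature.trace_re_rep_inv ρ hρu]
  congr 3
  group

/-- **The spatial plaquette sum as half the sum over ORDERED pairs of distinct directions** (each plaquette counted
with both orientations, which contribute equally). [folklore] -/
theorem magSum_eq_half_sum_ne [NeZero L] (hρu : ∀ g, ρ g ∈ Matrix.unitaryGroup (Fin n) ℂ) (a : GaugeConfig k L G) :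
    magSum (d := k) (L := L) ρ a = (1 / 2 : ℝ) * ∑ x : Site k L, ∑ i : Fin k, ∑ j : Fin k,
      if i ≠ j then (ρ (a (x, i) * a (x + Pi.single i 1, j) * (a (x + Pi.single j 1, i))⁻¹ * (a (x, j))⁻¹)).trace.re
      else 0 := by
  classical
  unfold magSum
  rw [Finset.mul_sum]
  refine Finset.sum_congr rfl fun x _ => ?_
  obtain ⟨S, hS⟩ : ∃ S : Fin k → Fin k → ℝ, ∀ i j,
      (ρ (a (x, i) * a (x + Pi.single i 1, j) * (a (x + Pi.single j 1, i))⁻¹ * (a (x, j))⁻¹)).trace.re = S i j :=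
    ⟨_, fun _ _ => rfl⟩
  have hsym : ∀ i j, S j i = S i j := fun i j => by
    rw [← hS j i, ← hS i j]
    exact plaquetteTrace_symm ρ hρu a x i j
  simp_rw [hS]
  have hsplit : ∀ i j : Fin k, (if i ≠ j then S i j else 0) = (if i < j then S i j else 0) + (if j < i then S i j else 0) := by
    intro i j
    rcases lt_trichotomy i j with h | h | h
    · simp [h, h.ne, lt_asymm h]
    · subst h; simp
    · simp [h, h.ne', lt_asymm h]
  simp_rw [hsplit, Finset.sum_add_distrib]
  have hswap : ∑ i : Fin k, ∑ j : Fin k, (if j < i then S i j else 0) = ∑ i : Fin k, ∑ j : Fin k, (if i < j then S i j else 0) := by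
    rw [Finset.sum_comm]
    refine Finset.sum_congr rfl fun i _ => Finset.sum_congr rfl fun j _ => ?_
    split_ifs with h
    · exact hsym i j
    · rfl
  rw [hswap, ← two_mul, ← mul_assoc, one_div_mul_cancel two_ne_zero, one_mul]
  rw [← Finset.sum_product']
  simp_rw [← Finset.sum_filter]
  rw [← Finset.sum_subtype_eq_sum_filter]
  refine Finset.sum_congr ?_ fun p _ => rfl
  ext p
  simp

/-- **The spatial plaquette sum is invariant under a coordinate permutation** (unitary `ρ`). [folklore] -/
theorem magSum_permConfig [NeZero L] (hρu : ∀ g, ρ g ∈ Matrix.unitaryGroup (Fin n) ℂ) (a : GaugeConfig k L G) :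
    magSum (d := k) (L := L) ρ (fun e : Edge k L => a (e.1 ∘ σ, σ.symm e.2)) = magSum (d := k) (L := L) ρ a := by
  rw [magSum_eq_half_sum_ne ρ hρu, magSum_eq_half_sum_ne ρ hρu]
  congr 1
  simp_rw [comp_perm_add_single σ]
  have hne : ∀ i j : Fin k, (σ.symm i ≠ σ.symm j) ↔ (i ≠ j) := fun i j => σ.symm.injective.ne_iff
  refine Fintype.sum_equiv ((Equiv.arrowCongr σ (Equiv.refl (ZMod L))).symm) _ _ fun y => ?_
  have hy : (Equiv.arrowCongr σ (Equiv.refl (ZMod L))).symm y = y ∘ σ := rfl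
  rw [hy]
  refine Fintype.sum_equiv σ.symm _ _ fun i => ?_
  refine Fintype.sum_equiv σ.symm _ _ fun j => ?_
  simp only [hne]

end Algebra

section Kernel

variable {G : Type*} [Group G] [TopologicalSpace G] [IsTopologicalGroup G] [CompactSpace G]
  [MeasurableSpace G] [BorelSpace G] {n k L : ℕ} [NeZero L] (ρ : G →* Matrix (Fin n) (Fin n) ℂ)
  (σ : Equiv.Perm (Fin k))

/-- **The coordinate permutation preserves the slice measure** (a relabelling of the product). [folklore] -/
theorem measurePreserving_permConfig :
    MeasurePreserving (fun (a : GaugeConfig k L G) (e : Edge k L) => a (e.1 ∘ σ, σ.symm e.2))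
      (sliceMeasure G k L) (sliceMeasure G k L) := by
  have h := measurePreserving_piCongrLeft (fun _ : Edge k L => haarProbability G)
    ((Equiv.arrowCongr σ (Equiv.refl (ZMod L))).prodCongr σ)
  have he : (⇑(MeasurableEquiv.piCongrLeft (fun _ : Edge k L => G) ((Equiv.arrowCongr σ (Equiv.refl (ZMod L))).prodCongr σ))) =
      fun (a : GaugeConfig k L G) (e : Edge k L) => a (e.1 ∘ σ, σ.symm e.2) := by
    funext a e
    simp only [MeasurableEquiv.coe_piCongrLeft, Equiv.piCongrLeft_apply_eq_cast, cast_eq, Equiv.prodCongr_symm,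
      Equiv.prodCongr_apply, Prod.map, Equiv.arrowCongr_symm, Equiv.refl_symm]
    rfl
  rw [he] at h
  exact h

/-- The site relabelling `E ↦ E ∘ (· ∘ σ⁻¹)` preserves integrals against the product Haar measure of the temporal
links. [folklore] -/
theorem integral_permSite (g : (Site k L → G) → ℝ) :
    ∫ E, g (fun x : Site k L => E (x ∘ σ.symm)) ∂(Measure.pi fun _ : Site k L => haarProbability G) =
      ∫ E, g E ∂(Measure.pi fun _ : Site k L => haarProbability G) := by
  have h := (measurePreserving_piCongrLeft (fun _ : Site k L => haarProbability G)
    (Equiv.arrowCongr σ.symm (Equiv.refl (ZMod L)))).integral_comp' (g := g)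
  have he : ∀ E : Site k L → G,
      (MeasurableEquiv.piCongrLeft (fun _ : Site k L => G) (Equiv.arrowCongr σ.symm (Equiv.refl (ZMod L)))) E =
        fun x : Site k L => E (x ∘ σ.symm) := by
    intro E
    funext x
    simp only [MeasurableEquiv.coe_piCongrLeft, Equiv.piCongrLeft_apply_eq_cast, cast_eq, Equiv.arrowCongr_symm,
      Equiv.refl_symm, Equiv.symm_symm]
    rfl
  simp_rw [he] at h
  exact h

/-- **The slice kernel is invariant under a coordinate permutation of both slices** (unitary `ρ`):
`K(Φ_σ a, Φ_σ b) = K(a, b)`. [folklore] -/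
theorem sliceKernel_permConfig (hρu : ∀ g, ρ g ∈ Matrix.unitaryGroup (Fin n) ℂ) (JE JM : ℝ) (a b : GaugeConfig k L G) :
    sliceKernel (d := k) (L := L) ρ JE JM (fun e : Edge k L => a (e.1 ∘ σ, σ.symm e.2))
        (fun e : Edge k L => b (e.1 ∘ σ, σ.symm e.2)) = sliceKernel (d := k) (L := L) ρ JE JM a b := by
  unfold sliceKernel
  rw [magSum_permConfig ρ σ hρu, magSum_permConfig ρ σ hρu]
  congr 2
  have h1 : ∀ E : Site k L → G, elecSum (d := k) (L := L) ρ (fun e : Edge k L => a (e.1 ∘ σ, σ.symm e.2)) E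
      (fun e : Edge k L => b (e.1 ∘ σ, σ.symm e.2)) =
      elecSum (d := k) (L := L) ρ a (fun x => E (x ∘ σ.symm)) b := by
    intro E
    have h := elecSum_permConfig ρ σ a b (fun x => E (x ∘ σ.symm))
    have hE : (fun y : Site k L => E ((y ∘ σ) ∘ σ.symm)) = E := by
      funext y; congr 1; funext i; simp
    simp only [hE] at h
    exact h
  simp_rw [h1]
  exact integral_permSite σ (fun E' => Real.exp (JE * elecSum (d := k) (L := L) ρ a E' b))

end Kernel

section Operator

variable {G : Type*} [Group G] [TopologicalSpace G] [IsTopologicalGroup G] [CompactSpace G]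
  [MeasurableSpace G] [BorelSpace G] [SecondCountableTopology G] {n k L : ℕ} [NeZero L]
  (ρ : G →* Matrix (Fin n) (Fin n) ℂ) (J : ℝ) (σ : Equiv.Perm (Fin k))

/-- **The relabelling isometry commutes with the transfer operator**: `U_σ ∘ T = T ∘ U_σ` (both sides have the
kernel `(a, b) ↦ K(Φ_σ a, b)`; continuous unitary `ρ`). [cite: Luscher1977] -/
theorem permOp_comp_tubeTransferOperator (hρ : Continuous ρ) (hρu : ∀ g, ρ g ∈ Matrix.unitaryGroup (Fin n) ℂ) :
    (Lp.compMeasurePreservingₗᵢ ℝ (fun (a : GaugeConfig k L G) (e : Edge k L) => a (e.1 ∘ σ, σ.symm e.2))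
        (measurePreserving_permConfig (G := G) (L := L) σ)).toContinuousLinearMap.comp (tubeTransferOperator ρ J k L) =
      (tubeTransferOperator ρ J k L).comp
        (Lp.compMeasurePreservingₗᵢ ℝ (fun (a : GaugeConfig k L G) (e : Edge k L) => a (e.1 ∘ σ, σ.symm e.2))
          (measurePreserving_permConfig (G := G) (L := L) σ)).toContinuousLinearMap := by
  set μ : Measure (GaugeConfig k L G) := sliceMeasure G k L with hμ
  set Φ : GaugeConfig k L G → GaugeConfig k L G := fun a e => a (e.1 ∘ σ, σ.symm e.2) with hΦ
  set K : GaugeConfig k L G → GaugeConfig k L G → ℝ := sliceKernel (d := k) (L := L) ρ J J with hK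
  have hmp : MeasurePreserving Φ μ μ := measurePreserving_permConfig (G := G) (L := L) σ
  have hKc : Continuous (uncurry K) := continuous_sliceKernel (d := k) (L := L) ρ hρ J J
  refine ContinuousLinearMap.ext fun φ => Lp.ext ?_
  rw [ContinuousLinearMap.comp_apply, ContinuousLinearMap.comp_apply]
  have hL : ((Lp.compMeasurePreservingₗᵢ ℝ Φ hmp).toContinuousLinearMap (tubeTransferOperator ρ J k L φ) :
      GaugeConfig k L G → ℝ) =ᵐ[μ] fun a => ∫ b, K (Φ a) b * φ b ∂μ := by
    refine (Lp.coeFn_compMeasurePreserving _ hmp).trans ?_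
    exact hmp.quasiMeasurePreserving.ae_eq_comp (tubeTransferOperator_ae_eq J k L hρ φ)
  have hR : (tubeTransferOperator ρ J k L ((Lp.compMeasurePreservingₗᵢ ℝ Φ hmp).toContinuousLinearMap φ) :
      GaugeConfig k L G → ℝ) =ᵐ[μ] fun a => ∫ b, K (Φ a) b * φ b ∂μ := by
    refine (tubeTransferOperator_ae_eq J k L hρ _).trans (Eventually.of_forall fun a => ?_)
    have hcs : (((Lp.compMeasurePreservingₗᵢ ℝ Φ hmp).toContinuousLinearMap φ : Lp ℝ 2 μ) : GaugeConfig k L G → ℝ)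
        =ᵐ[μ] (φ : GaugeConfig k L G → ℝ) ∘ Φ := Lp.coeFn_compMeasurePreserving φ hmp
    have h1 : ∫ b, K a b * (((Lp.compMeasurePreservingₗᵢ ℝ Φ hmp).toContinuousLinearMap φ : Lp ℝ 2 μ) :
        GaugeConfig k L G → ℝ) b ∂μ = ∫ b, K a b * φ (Φ b) ∂μ := by
      refine integral_congr_ae ?_
      filter_upwards [hcs] with b hb
      rw [hb, Function.comp_apply]
    have h2 : ∫ b, K a b * φ (Φ b) ∂μ = ∫ b, (fun c => K (Φ a) c * φ c) (Φ b) ∂μ := by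
      refine integral_congr_ae (Eventually.of_forall fun b => ?_)
      simp only [hK, hΦ, sliceKernel_permConfig ρ σ hρu]
    have hg : AEStronglyMeasurable (fun c => K (Φ a) c * φ c) μ :=
      ((hKc.comp (Continuous.prodMk continuous_const continuous_id)).aestronglyMeasurable).mul
        (Lp.aestronglyMeasurable φ)
    have h3 : ∫ b, (fun c => K (Φ a) c * φ c) (Φ b) ∂μ = ∫ c, K (Φ a) c * φ c ∂μ := by
      have hg' : AEStronglyMeasurable (fun c => K (Φ a) c * φ c) (Measure.map Φ μ) := by rw [hmp.map_eq]; exact hg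
      have := integral_map hmp.measurable.aemeasurable hg'
      rw [hmp.map_eq] at this
      exact this.symm
    dsimp only
    rw [h1, h2, h3]
  exact hL.trans hR.symm

omit [TopologicalSpace G] [IsTopologicalGroup G] [CompactSpace G] [MeasurableSpace G] [BorelSpace G]
  [SecondCountableTopology G] [NeZero L] in
/-- **The relabelling intertwines the twists**: `Φ_σ (twist_s a) = twist_{s ∘ σ⁻¹} (Φ_σ a)`. [cite: tHooft1979Flux] -/
theorem permConfig_fluxTwist (z : G) (s : Fin k → ZMod 2) (a : GaugeConfig k L G) :
    (fun e : Edge k L => fluxTwist z s a (e.1 ∘ σ, σ.symm e.2)) =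
      fluxTwist z (s ∘ σ.symm) (fun e : Edge k L => a (e.1 ∘ σ, σ.symm e.2)) := by
  funext e
  simp only [fluxTwist_apply, fluxTwistPrefactor, comp_apply, Equiv.apply_symm_apply]
  congr 1

omit [SecondCountableTopology G] in
/-- `C_s ∘ U_σ = U_σ ∘ C_{s ∘ σ⁻¹}` for the twist operators. [cite: tHooft1979Flux] -/
theorem fluxTwistOp_comp_permOp (z : G) (s : Fin k → ZMod 2) :
    (fluxTwistOp k L z s).comp
        (Lp.compMeasurePreservingₗᵢ ℝ (fun (a : GaugeConfig k L G) (e : Edge k L) => a (e.1 ∘ σ, σ.symm e.2))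
          (measurePreserving_permConfig (G := G) (L := L) σ)).toContinuousLinearMap =
      (Lp.compMeasurePreservingₗᵢ ℝ (fun (a : GaugeConfig k L G) (e : Edge k L) => a (e.1 ∘ σ, σ.symm e.2))
          (measurePreserving_permConfig (G := G) (L := L) σ)).toContinuousLinearMap.comp
        (fluxTwistOp k L z (s ∘ σ.symm)) := by
  set μ : Measure (GaugeConfig k L G) := sliceMeasure G k L with hμ
  set Φ : GaugeConfig k L G → GaugeConfig k L G := fun a e => a (e.1 ∘ σ, σ.symm e.2) with hΦ
  have hmp : MeasurePreserving Φ μ μ := measurePreserving_permConfig (G := G) (L := L) σ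
  have hmt : MeasurePreserving (fluxTwist (L := L) z s) μ μ := measurePreserving_fluxTwist z s
  have hmt' : MeasurePreserving (fluxTwist (L := L) z (s ∘ σ.symm)) μ μ := measurePreserving_fluxTwist z _
  refine ContinuousLinearMap.ext fun φ => Lp.ext ?_
  rw [ContinuousLinearMap.comp_apply, ContinuousLinearMap.comp_apply]
  have hL := (fluxTwistOp_ae_eq (L := L) z s ((Lp.compMeasurePreservingₗᵢ ℝ Φ hmp).toContinuousLinearMap φ)).trans
    (hmt.quasiMeasurePreserving.ae_eq_comp (Lp.coeFn_compMeasurePreserving φ hmp))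
  have hR := (Lp.coeFn_compMeasurePreserving (fluxTwistOp k L z (s ∘ σ.symm) φ) hmp).trans
    (hmp.quasiMeasurePreserving.ae_eq_comp (fluxTwistOp_ae_eq (L := L) z (s ∘ σ.symm) φ))
  refine hL.trans (Eventually.of_forall fun a => ?_) |>.trans hR.symm
  simp only [Function.comp_apply]
  congr 1
  exact permConfig_fluxTwist σ z s a

omit [Group G] [TopologicalSpace G] [IsTopologicalGroup G] [CompactSpace G] [MeasurableSpace G] [BorelSpace G]
  [SecondCountableTopology G] [NeZero L] in
/-- The sign character is invariant under a simultaneous relabelling: `χ_{e∘σ}(s∘σ) = χ_e(s)`. [folklore] -/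
theorem fluxSign_comp_perm (e s : Fin k → ZMod 2) : fluxSign (e ∘ σ) (s ∘ σ) = fluxSign e s := by
  unfold fluxSign
  exact Fintype.prod_equiv σ _ _ fun μ => rfl

omit [SecondCountableTopology G] in
/-- **The sector projections under relabelling**: `P_{e∘σ} ∘ U_σ = U_σ ∘ P_e`. [cite: tHooft1979Flux] -/
theorem tubeFluxProjection_comp_permOp (z : G) (e : Fin k → ZMod 2) :
    (tubeFluxProjection z k L (e ∘ σ)).comp
        (Lp.compMeasurePreservingₗᵢ ℝ (fun (a : GaugeConfig k L G) (e : Edge k L) => a (e.1 ∘ σ, σ.symm e.2))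
          (measurePreserving_permConfig (G := G) (L := L) σ)).toContinuousLinearMap =
      (Lp.compMeasurePreservingₗᵢ ℝ (fun (a : GaugeConfig k L G) (e : Edge k L) => a (e.1 ∘ σ, σ.symm e.2))
          (measurePreserving_permConfig (G := G) (L := L) σ)).toContinuousLinearMap.comp (tubeFluxProjection z k L e) := by
  unfold tubeFluxProjection fluxProjection
  rw [ContinuousLinearMap.smul_comp, ContinuousLinearMap.comp_smul, ContinuousLinearMap.finsetSum_comp,
    ContinuousLinearMap.comp_finsetSum]
  congr 1
  symm
  refine Fintype.sum_equiv (Equiv.arrowCongr σ.symm (Equiv.refl (ZMod 2))) _ _ fun t => ?_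
  have ht : (Equiv.arrowCongr σ.symm (Equiv.refl (ZMod 2))) t = t ∘ σ := by
    funext i; simp [Equiv.arrowCongr_apply]
  have htt : ((t ∘ σ) ∘ σ.symm : Fin k → ZMod 2) = t := by
    funext i; simp
  rw [ht, ContinuousLinearMap.smul_comp, ContinuousLinearMap.comp_smul, fluxTwistOp_comp_permOp σ z (t ∘ σ), htt,
    fluxSign_comp_perm σ e t]

/-- **Sector tops under coordinate permutations**: `‖T ∘ P_{e ∘ σ}‖ ≤ ‖T ∘ P_e‖` (and hence `=` by symmetry,
`tubeSectorNorm_perm`). [cite: tHooft1979Flux] -/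
theorem tubeSectorNorm_perm_le (hρ : Continuous ρ) (hρu : ∀ g, ρ g ∈ Matrix.unitaryGroup (Fin n) ℂ) (z : G)
    (e : Fin k → ZMod 2) : tubeSectorNorm ρ z J k L (e ∘ σ) ≤ tubeSectorNorm ρ z J k L e := by
  set U : Lp ℝ 2 (sliceMeasure G k L) →ₗᵢ[ℝ] Lp ℝ 2 (sliceMeasure G k L) :=
    (Lp.compMeasurePreservingₗᵢ ℝ (fun (a : GaugeConfig k L G) (e : Edge k L) => a (e.1 ∘ σ, σ.symm e.2))
      (measurePreserving_permConfig (G := G) (L := L) σ)) with hU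
  set U' : Lp ℝ 2 (sliceMeasure G k L) →ₗᵢ[ℝ] Lp ℝ 2 (sliceMeasure G k L) :=
    (Lp.compMeasurePreservingₗᵢ ℝ (fun (a : GaugeConfig k L G) (e : Edge k L) => a (e.1 ∘ σ.symm, σ.symm.symm e.2))
      (measurePreserving_permConfig (G := G) (k := k) (L := L) σ.symm)) with hU'
  change ‖(tubeTransferOperator ρ J k L).comp (tubeFluxProjection z k L (e ∘ σ))‖ ≤
    ‖(tubeTransferOperator ρ J k L).comp (tubeFluxProjection z k L e)‖
  have h : ((tubeTransferOperator ρ J k L).comp (tubeFluxProjection z k L (e ∘ σ))).comp U.toContinuousLinearMap =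
      U.toContinuousLinearMap.comp ((tubeTransferOperator ρ J k L).comp (tubeFluxProjection z k L e)) := by
    rw [ContinuousLinearMap.comp_assoc, tubeFluxProjection_comp_permOp σ z e, ← ContinuousLinearMap.comp_assoc,
      ← permOp_comp_tubeTransferOperator ρ J σ hρ hρu, ContinuousLinearMap.comp_assoc]
  have hUU' : ∀ ψ, U.toContinuousLinearMap (U'.toContinuousLinearMap ψ) = ψ := by
    intro ψ
    apply Lp.ext
    have h1' := Lp.coeFn_compMeasurePreserving (U'.toContinuousLinearMap ψ) (measurePreserving_permConfig (G := G) (L := L) σ)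
    have h2' := (measurePreserving_permConfig (G := G) (L := L) σ).quasiMeasurePreserving.ae_eq_comp
      (Lp.coeFn_compMeasurePreserving ψ (measurePreserving_permConfig (G := G) (k := k) (L := L) σ.symm))
    refine h1'.trans (h2'.trans (Eventually.of_forall fun a => ?_))
    simp only [Function.comp_apply]
    congr 1
    funext e'
    simp only [Equiv.symm_symm, Equiv.symm_apply_apply]
    congr 1
    refine Prod.ext ?_ rfl
    funext i
    simp
  refine ContinuousLinearMap.opNorm_le_bound _ (norm_nonneg _) fun ψ => ?_
  have happly := congrArg (fun A => A (U'.toContinuousLinearMap ψ)) h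
  simp only [ContinuousLinearMap.comp_apply, hUU'] at happly
  rw [ContinuousLinearMap.comp_apply, happly]
  calc ‖U.toContinuousLinearMap ((tubeTransferOperator ρ J k L) ((tubeFluxProjection z k L e) (U'.toContinuousLinearMap ψ)))‖
      = ‖(tubeTransferOperator ρ J k L) ((tubeFluxProjection z k L e) (U'.toContinuousLinearMap ψ))‖ :=
        U.norm_map _
    _ ≤ ‖(tubeTransferOperator ρ J k L).comp (tubeFluxProjection z k L e)‖ * ‖U'.toContinuousLinearMap ψ‖ :=
        ((tubeTransferOperator ρ J k L).comp (tubeFluxProjection z k L e)).le_opNorm _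
    _ = ‖(tubeTransferOperator ρ J k L).comp (tubeFluxProjection z k L e)‖ * ‖ψ‖ := by
        have hn : ‖U'.toContinuousLinearMap ψ‖ = ‖ψ‖ := U'.norm_map ψ
        rw [hn]

/-- **Sector tops are invariant under coordinate permutations**: `‖T ∘ P_{e ∘ σ}‖ = ‖T ∘ P_e‖`.
[cite: tHooft1979Flux] -/
theorem tubeSectorNorm_perm (hρ : Continuous ρ) (hρu : ∀ g, ρ g ∈ Matrix.unitaryGroup (Fin n) ℂ) (z : G)
    (e : Fin k → ZMod 2) : tubeSectorNorm ρ z J k L (e ∘ σ) = tubeSectorNorm ρ z J k L e := by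
  refine le_antisymm (tubeSectorNorm_perm_le ρ J (L := L) σ hρ hρu z e) ?_
  have h := tubeSectorNorm_perm_le ρ J (L := L) σ.symm hρ hρu z (e ∘ σ)
  have he : ((e ∘ σ) ∘ σ.symm : Fin k → ZMod 2) = e := by
    funext i; simp
  rw [he] at h
  exact h

/-- **Flux energies are invariant under coordinate permutations**: `E_{e ∘ σ} = E_e`. [cite: tHooft1979Flux] -/
theorem tubeFluxEnergy_perm (hρ : Continuous ρ) (hρu : ∀ g, ρ g ∈ Matrix.unitaryGroup (Fin n) ℂ) (z : G)
    (e : Fin k → ZMod 2) : tubeFluxEnergy ρ z J k L (e ∘ σ) = tubeFluxEnergy ρ z J k L e := by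
  unfold tubeFluxEnergy fluxEnergy
  rw [show sectorNorm (tubeTransferOperator ρ J k L) (fluxTwistOp k L z) (e ∘ σ) =
      tubeSectorNorm ρ z J k L (e ∘ σ) from rfl, tubeSectorNorm_perm ρ J (L := L) σ hρ hρu z e]
  rfl

/-- **The torelon energy does not depend on the axis**: `torelonEnergy … μ = torelonEnergy … ν` (transposition of
the two axes). [cite: tHooft1979Flux] -/
theorem torelonEnergy_axis (hρ : Continuous ρ) (hρu : ∀ g, ρ g ∈ Matrix.unitaryGroup (Fin n) ℂ) (z : G)
    (μ ν : Fin k) : torelonEnergy ρ z J k L μ = torelonEnergy ρ z J k L ν := by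
  unfold torelonEnergy
  have h := tubeFluxEnergy_perm ρ J (L := L) (Equiv.swap μ ν) hρ hρu z (Pi.single μ 1)
  have he : ((Pi.single μ 1 : Fin k → ZMod 2) ∘ (Equiv.swap μ ν)) = Pi.single ν 1 := by
    funext i
    simp only [comp_apply, Pi.single_apply, Equiv.swap_apply_eq_iff, Equiv.swap_apply_left]
  rw [he] at h
  exact h.symm

end Operator

section SU2

open Literature.MathematicalPhysics.QuantumLattice (fundamentalRep continuous_fundamentalRep fundamentalRep_mem_unitaryGroup
  secondCountableTopology_su2)

/-- **The `SU(2)` torelon energy is the same along every axis of a cubic cross-section** `(ℤ/L)^k`, for every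
Wilson coupling `β` — the FLOW-TABLE's axis-`0` column `E1` is the torelon energy of the tube. [cite: tHooft1979Flux] -/
theorem su2TorelonEnergy_axis (β : ℝ) (k L : ℕ) [NeZero L] (μ ν : Fin k) :
    su2TorelonEnergy β k L μ = su2TorelonEnergy β k L ν := by
  haveI : SecondCountableTopology (Matrix.specialUnitaryGroup (Fin 2) ℂ) := secondCountableTopology_su2
  exact torelonEnergy_axis (fundamentalRep (Fin 2)) (β / 2) (continuous_fundamentalRep (Fin 2))
    fundamentalRep_mem_unitaryGroup su2MinusOne μ ν

end SU2

end Summit.Ventures.YMGap.FlowData
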